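import Summits.HodgeConjecture.HodgeConjecture.Theorems.F0P3cStCharTSStIwahoriFixed     -- ★ (G6)-ST FILE D (F0P3a-p06): `valued_diag_le_one_of_mem_K1`; brings FILE C (`cover_borel_I∕K1`, `disj_borel_I`, `coe_eA_apply`, …), FILE A, ★ SphericalLine
import HarnessLib

/-!
# «PS-LEVELS» (cells): the inducing line of `i_G(χ₁, χ₂)` on `B ∩ K_v`, `B ∩ K₁`, the Bruhat–Iwahori cells, and the witness `t ∈ T ∩ K_v`
# (E1 ROW 35 «EP-CROSS (i) @ DATUM», input (C3a); Borel 1976 §3–§4, Casselman 1995 §3 ∕ Prop. 1.3.1, Rogawski 1990 §12.2)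

Cell `pub/hodgecm-mathlib`, crux H413 = `stmt-HodgeConjecture-24833`, LH6 leaf, organ (S-𝔑) `stub_EllipticInputs`, consequent 3 (`h61bRest`); E1 row 35 (keeper
F0P3a-p03 (g29); seat LH6-p03 (g9)).  THEOREMS ONLY (`--supports`, `--as helper`); no `def`, no instance, no notation, no `sorry`.  The general-pair twins of ★ (G6)-ST
FILE A §3 ∕ FILE D §2–§3 (there `χ = χ_St(ψ₀)`; here ANY pair `(χ₁, χ₂)`), in the letters of ★ (G3)-EXPLICIT (`w hw eA heA hd g₁ hg₁ K0 K1 I hK0 hK1 hI`).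

WHAT.  Write `U(χ) :≡ ∀ t ∈ T, t ∈ K_v → χ t = 1` («`χ` unramified»: `χ₁` trivial on `𝒪_v^×` and `χ₂ = 1`).  Then for `V = i_G(χ)` (★ `cmPrincipalSeries L 3 v χ`):
`dim V^{K0} = [U]`, `dim V^{K1} = [U]`, `dim V^{I} = 2·[U]` — the levels input `(1,1,2)` ∕ `(0,0,0)` of ★ E1-28 `IrrClass.ep_eq_zero_of_constituents_pair`.
* §1 under `U`: the inducing line `χ∘proj ⊗ δ_B^{1∕2}` is trivial on `B ∩ K` for `K ∈ {K_v, K1}` and on both Bruhat–Iwahori cells' `B ∩ gIg⁻¹` (`δ = 1` on compacta,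
  `proj(B ∩ K) ⊆ T ∩ K_v` — for `K1` by FILE D's unit-diagonal lemma).
* §2 under `¬U`: a WITNESS `t ∈ T ∩ K_v` with `χ t ≠ 1` lies in `K0`, in `I`, in `K1`, and `w̃⁻¹ t w̃ ∈ I` (diagonal with unit entries in the model, ★ Iwahori test), and acts on
  the line by `χ t ≠ 1`.
* the three counts themselves are the sequel file `F0P3cStCharTSPSLevels` (§3 there).

HONEST LABEL: count-neutral helper (row 35 input); h413 OPEN; HC_CM is proved only modulo the 7 printed citations (2 remaining: hLiu418 =
stmt-HodgeConjecture-24832, h413 = stmt-HodgeConjecture-24833) until rung 0 closes.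
## References
* [Borel1976] A. Borel, *Admissible representations of a semi-simple group over a local field with vectors fixed under an Iwahori subgroup*, Invent. Math. 35 (1976), §3–§4.
* [Casselman1995] W. Casselman, *Introduction to the theory of admissible representations of p-adic reductive groups* (1995), Prop. 1.3.1, §3.
* [Rogawski1990] J. D. Rogawski, *Automorphic Representations of Unitary Groups in Three Variables*, Ann. of Math. Stud. 123 (1990), §4.5 p. 45, §12.1 p. 171, §12.2 pp. 173–174.
* [BruhatTits1972] F. Bruhat, J. Tits, *Groupes réductifs sur un corps local I*, Publ. Math. IHÉS 41 (1972), (4.4.3)–(4.4.4).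
* [CartierCorvallis1979] P. Cartier, *Representations of p-adic groups: a survey*, PSPM 33.1 (1979), §III.3, §IV.1.
-/

set_option autoImplicit false
-- the mandated namespace has the single-problem summit's repeated segment (`HodgeConjecture.HodgeConjecture`)
set_option linter.dupNamespace false

noncomputable section

open NumberField IsDedekindDomain MeasureTheory
open scoped Matrix MatrixGroups NNReal WithZero
open Literature.NumberTheory.Automorphic Literature.NumberTheory.Automorphic.UnitaryGroup
open Literature.NumberTheory.Rogawski1990 Literature.NumberTheory.GaloisRepresentations

namespace Summit.HodgeConjecture.HodgeConjecture.Cruxes.H413.F0P3cStCharTSPSLevelsCells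

open Summit.HodgeConjecture.HodgeConjecture.Cruxes.H413
open Summit.HodgeConjecture.HodgeConjecture.Cruxes.H413.F0P3cStCharTSStLevelsTransport
open Summit.HodgeConjecture.HodgeConjecture.Cruxes.H413.F0P3cStCharTSStIwahoriFixed

variable (L : Type) [Field L] [NumberField L] [IsCMField L] (v : HeightOneSpectrum (𝓞 ↥(maximalRealSubfield L)))
  (w : PlacesOver L v) (hw : IsCMField.complexConj L • w.1 = w.1)
  (eA : Gqs L v ≃ₜ* ↥(unitaryGroupOfForm (galAdicCompletionMap (L := L) (IsCMField.complexConj L) hw) ((StdForm.antidiagonal 3).over (w.1.adicCompletion L))))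
  (heA : ∀ g : Gqs L v,
    ((eA g : ↥(unitaryGroupOfForm (galAdicCompletionMap (L := L) (IsCMField.complexConj L) hw) ((StdForm.antidiagonal 3).over (w.1.adicCompletion L)))) : GL (Fin 3) (w.1.adicCompletion L)) =
      ((localNonsplitEquiv (IsCMField.complexConj L) (qsForm L) (IsCMField.complexConj_ne_one L) w hw g :
        ↥(unitaryGroupOfForm (galAdicCompletionMap (L := L) (IsCMField.complexConj L) hw) (placeForm (qsForm L) w.1))) : GL (Fin 3) (w.1.adicCompletion L)))

/-! ## §1 Under `U`: the inducing line is trivial on `B ∩ K_v`, `B ∩ K1` -/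

set_option maxHeartbeats 1600000 in
-- instance-path unification between `Gqs L v` and the literal carrier of ★ `cmPrincipalSeries`
/-- **The inducing line `χ∘proj ⊗ δ_B^{1∕2}` is trivial at `h ∈ B ∩ K`** whenever `K` is compact (`δ_B^{1∕2}(h) = 1`, ★ `rootDeltaChar_borel_eq_one_of_mem_isCompact`), `proj h ∈ K_v`
and `χ ≡ 1` on `T ∩ K_v`. [cite: Rogawski1990, §4.5 p. 45; §12.1 p. 171] [cite: CartierCorvallis1979, §III.3, §IV.1] -/
theorem inducingLine_eq_one_of_proj_mem (χ : ↥(torusU (conjLocal L (IsCMField.complexConj L) v) (cmLocalForm L 3 v)) →* ℂˣ)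
    (hU : ∀ t : ↥(torusU (conjLocal L (IsCMField.complexConj L) v) (cmLocalForm L 3 v)),
      (t : ↥(unitaryGroupOfForm (conjLocal L (IsCMField.complexConj L) v) (cmLocalForm L 3 v))) ∈ cmLocalIntegralLevel L 3 (qsForm L) v → χ t = 1)
    {K : Subgroup ↥(unitaryGroupOfForm (conjLocal L (IsCMField.complexConj L) v) (cmLocalForm L 3 v))}
    (hKc : IsCompact (K : Set ↥(unitaryGroupOfForm (conjLocal L (IsCMField.complexConj L) v) (cmLocalForm L 3 v))))
    (h : ↥(cmBorelTriple L 3 v).P) (hh : (h : ↥(unitaryGroupOfForm (conjLocal L (IsCMField.complexConj L) v) (cmLocalForm L 3 v))) ∈ K)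
    (hproj : (((cmBorelTriple L 3 v).proj h : ↥(torusU (conjLocal L (IsCMField.complexConj L) v) (cmLocalForm L 3 v))) :
      ↥(unitaryGroupOfForm (conjLocal L (IsCMField.complexConj L) v) (cmLocalForm L 3 v))) ∈ cmLocalIntegralLevel L 3 (qsForm L) v) :
    haveI := locallyCompactSpace_cmBorelU L 3 v
    (Representation.twist
      (((Representation.trivial ℂ ↥(torusU (conjLocal L (IsCMField.complexConj L) v) (cmLocalForm L 3 v)) ℂ).twist χ).comp (cmBorelTriple L 3 v).proj)
      (rootDeltaChar (cmBorelTriple L 3 v).P)) h = 1 := by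
  haveI := locallyCompactSpace_cmBorelU L 3 v
  have hδ : rootDeltaChar (cmBorelTriple L 3 v).P h = 1 := rootDeltaChar_borel_eq_one_of_mem_isCompact _ _ (cmLocalForm_eq_over L 3 v) hKc h hh
  have hχ : χ ((cmBorelTriple L 3 v).proj h) = 1 := hU _ hproj
  apply LinearMap.ext
  intro z
  rw [Representation.twist_apply, hδ, Units.val_one, one_smul, MonoidHom.comp_apply, Representation.twist_apply, Representation.trivial_apply,
    hχ, Units.val_one, one_smul, Module.End.one_apply]

set_option maxHeartbeats 1600000 in
-- instance-path unification between `Gqs L v` and the literal carrier of ★ `cmPrincipalSeries`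
/-- **On `B ∩ K_v`** the inducing line of an unramified `χ` is trivial (`proj(B ∩ K_v) ⊆ K_v`, ★ `proj_mem_cmLocalIntegralLevel`).
[cite: Rogawski1990, §4.5 p. 45] [cite: CartierCorvallis1979, §IV.1] -/
theorem inducingLine_eq_one_of_mem_integralLevel (χ : ↥(torusU (conjLocal L (IsCMField.complexConj L) v) (cmLocalForm L 3 v)) →* ℂˣ)
    (hU : ∀ t : ↥(torusU (conjLocal L (IsCMField.complexConj L) v) (cmLocalForm L 3 v)),
      (t : ↥(unitaryGroupOfForm (conjLocal L (IsCMField.complexConj L) v) (cmLocalForm L 3 v))) ∈ cmLocalIntegralLevel L 3 (qsForm L) v → χ t = 1)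
    (h : ↥(cmBorelTriple L 3 v).P)
    (hh : (h : ↥(unitaryGroupOfForm (conjLocal L (IsCMField.complexConj L) v) (cmLocalForm L 3 v))) ∈ cmLocalIntegralLevel L 3 (qsForm L) v) :
    haveI := locallyCompactSpace_cmBorelU L 3 v
    (Representation.twist
      (((Representation.trivial ℂ ↥(torusU (conjLocal L (IsCMField.complexConj L) v) (cmLocalForm L 3 v)) ℂ).twist χ).comp (cmBorelTriple L 3 v).proj)
      (rootDeltaChar (cmBorelTriple L 3 v).P)) h = 1 :=
  inducingLine_eq_one_of_proj_mem L v χ hU (isCompact_isOpen_cmLocalIntegralLevel L 3 (qsForm L) v).1 h hh (proj_mem_cmLocalIntegralLevel L 3 v h hh)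

include heA in
set_option maxHeartbeats 1600000 in
-- instance-path unification between `Gqs L v` and the literal carrier of ★ `cmPrincipalSeries`
/-- **On `B ∩ K₁`** the inducing line of an unramified `χ` is trivial: the diagonal of `h ∈ B ∩ K₁` and of `h⁻¹ ∈ B ∩ K₁` is integral (FILE D `valued_diag_le_one_of_mem_K1`),
so `proj h ∈ K_v` (★ `mem_cmLocalIntegralLevel_iff_forall_v_le_one`, ★ `val_proj_borelTriple`, `val_proj_inv_borelTriple`); `K₁` is compact (FILE C).
[cite: Tits1979, §3.3.2] [cite: Rogawski1990, §4.5 p. 45] -/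
theorem inducingLine_eq_one_of_mem_K1 {ϖ : w.1.adicCompletion L}
    (hd : HermitianLattice.UnramifiedLocalConjDatum (galAdicCompletionMap (L := L) (IsCMField.complexConj L) hw) ϖ)
    (g₁ : GL (Fin 3) (w.1.adicCompletion L)) (hg₁ : (g₁ : Matrix (Fin 3) (Fin 3) (w.1.adicCompletion L)) = Matrix.diagonal ![(1 : w.1.adicCompletion L), 1, ϖ])
    (K0 K1 I : Subgroup (Gqs L v))
    (hK0 : K0 = ((glInt 3 (w.1.adicCompletion L)).subgroupOf
      (unitaryGroupOfForm (galAdicCompletionMap (L := L) (IsCMField.complexConj L) hw) ((StdForm.antidiagonal 3).over (w.1.adicCompletion L)))).comap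
        eA.toMulEquiv.toMonoidHom)
    (hK1 : K1 = (((glInt 3 (w.1.adicCompletion L)).map (MulAut.conj g₁).toMonoidHom).subgroupOf
      (unitaryGroupOfForm (galAdicCompletionMap (L := L) (IsCMField.complexConj L) hw) ((StdForm.antidiagonal 3).over (w.1.adicCompletion L)))).comap
        eA.toMulEquiv.toMonoidHom)
    (hI : I = K0 ⊓ K1)
    (χ : ↥(torusU (conjLocal L (IsCMField.complexConj L) v) (cmLocalForm L 3 v)) →* ℂˣ)
    (hU : ∀ t : ↥(torusU (conjLocal L (IsCMField.complexConj L) v) (cmLocalForm L 3 v)),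
      (t : ↥(unitaryGroupOfForm (conjLocal L (IsCMField.complexConj L) v) (cmLocalForm L 3 v))) ∈ cmLocalIntegralLevel L 3 (qsForm L) v → χ t = 1)
    (h : ↥(cmBorelTriple L 3 v).P) (hh : (h : ↥(unitaryGroupOfForm (conjLocal L (IsCMField.complexConj L) v) (cmLocalForm L 3 v))) ∈ K1) :
    haveI := locallyCompactSpace_cmBorelU L 3 v
    (Representation.twist
      (((Representation.trivial ℂ ↥(torusU (conjLocal L (IsCMField.complexConj L) v) (cmLocalForm L 3 v)) ℂ).twist χ).comp (cmBorelTriple L 3 v).proj)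
      (rootDeltaChar (cmBorelTriple L 3 v).P)) h = 1 := by
  haveI : Subsingleton (PlacesOver L v) := PlacesOver.subsingleton_of_smul_eq (IsCMField.complexConj L) (IsCMField.complexConj_ne_one L) w hw
  have hK1c := (isOpen_isCompact_levels L v w hw eA g₁ K0 K1 I hK0 hK1 hI).2.1.2
  have hK1sub : ∀ x : ↥(unitaryGroupOfForm (conjLocal L (IsCMField.complexConj L) v) (cmLocalForm L 3 v)), x ∈ K1 → x⁻¹ ∈ K1 := fun x hx => K1.inv_mem hx
  have hhinv : ((h⁻¹ : ↥(cmBorelTriple L 3 v).P) : ↥(unitaryGroupOfForm (conjLocal L (IsCMField.complexConj L) v) (cmLocalForm L 3 v))) ∈ K1 := hK1sub _ hh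
  refine inducingLine_eq_one_of_proj_mem L v χ hU (K := K1) hK1c h hh ?_
  refine (mem_cmLocalIntegralLevel_iff_forall_v_le_one L 3 v _).2 ⟨fun i j w' => ?_, fun i j w' => ?_⟩
  · obtain rfl : w' = w := Subsingleton.elim _ _
    rw [val_proj_borelTriple, Matrix.diagonal_apply]
    split_ifs with hij
    · exact valued_diag_le_one_of_mem_K1 L v w' hw eA heA hd g₁ hg₁ K1 hK1 _ hh i
    · rw [Pi.zero_apply, map_zero]; exact zero_le
  · obtain rfl : w' = w := Subsingleton.elim _ _
    rw [val_proj_inv_borelTriple, Matrix.diagonal_apply]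
    split_ifs with hij
    · exact valued_diag_le_one_of_mem_K1 L v w' hw eA heA hd g₁ hg₁ K1 hK1 _ hhinv i
    · rw [Pi.zero_apply, map_zero]; exact zero_le

/-! ## §2 Under `¬U`: the witness `t ∈ T ∩ K_v`, `χ t ≠ 1`, and the cells it lies in -/

/-- **A diagonal element of `G_v` whose model matrix is `diag(e)` with `|eᵢ|_w = 1` lies in the Iwahori level `I = K0 ⊓ K1`** (★ Iwahori test
`mem_glInt_inf_conj_glInt_iff`: integral entries, the three lower entries `0 ∈ 𝔭`).  The general form of FILE C `mem_I_of_coe_eq_diagonal`.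
[cite: Tits1979, §3.7] [cite: BruhatTits1972, (4.4.4)] -/
theorem mem_I_of_model_diagonal {ϖ : w.1.adicCompletion L}
    (hd : HermitianLattice.UnramifiedLocalConjDatum (galAdicCompletionMap (L := L) (IsCMField.complexConj L) hw) ϖ)
    (g₁ : GL (Fin 3) (w.1.adicCompletion L)) (hg₁ : (g₁ : Matrix (Fin 3) (Fin 3) (w.1.adicCompletion L)) = Matrix.diagonal ![(1 : w.1.adicCompletion L), 1, ϖ])
    (K0 K1 I : Subgroup (Gqs L v))
    (hK0 : K0 = ((glInt 3 (w.1.adicCompletion L)).subgroupOf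
      (unitaryGroupOfForm (galAdicCompletionMap (L := L) (IsCMField.complexConj L) hw) ((StdForm.antidiagonal 3).over (w.1.adicCompletion L)))).comap
        eA.toMulEquiv.toMonoidHom)
    (hK1 : K1 = (((glInt 3 (w.1.adicCompletion L)).map (MulAut.conj g₁).toMonoidHom).subgroupOf
      (unitaryGroupOfForm (galAdicCompletionMap (L := L) (IsCMField.complexConj L) hw) ((StdForm.antidiagonal 3).over (w.1.adicCompletion L)))).comap
        eA.toMulEquiv.toMonoidHom)
    (hI : I = K0 ⊓ K1)
    (g : Gqs L v) (e : Fin 3 → w.1.adicCompletion L) (he : ∀ i, Valued.v (e i) = 1)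
    (hg : (((eA g : ↥(unitaryGroupOfForm (galAdicCompletionMap (L := L) (IsCMField.complexConj L) hw)
      ((StdForm.antidiagonal 3).over (w.1.adicCompletion L)))) : GL (Fin 3) (w.1.adicCompletion L)) : Matrix (Fin 3) (Fin 3) (w.1.adicCompletion L)) =
        Matrix.diagonal e) :
    g ∈ I := by
  subst hI hK0 hK1
  rw [Subgroup.mem_inf, Subgroup.mem_comap, Subgroup.mem_comap]
  change eA g ∈ (glInt 3 (w.1.adicCompletion L)).subgroupOf _ ∧ eA g ∈ ((glInt 3 (w.1.adicCompletion L)).map (MulAut.conj g₁).toMonoidHom).subgroupOf _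
  rw [← Subgroup.mem_inf, mem_glInt_inf_conj_glInt_iff (galAdicCompletionMap (L := L) (IsCMField.complexConj L) hw) rfl hd.vσ hd.vϖ g₁ hg₁, hg]
  refine ⟨fun i j => ?_, ?_, ?_, ?_⟩
  · rw [Matrix.diagonal_apply]
    split_ifs with hij
    · exact (he i).le
    · rw [map_zero]; exact zero_le
  · rw [Matrix.diagonal_apply_ne _ (by decide), map_zero]; exact zero_lt_one
  · rw [Matrix.diagonal_apply_ne _ (by decide), map_zero]; exact zero_lt_one
  · rw [Matrix.diagonal_apply_ne _ (by decide), map_zero]; exact zero_lt_one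

set_option maxHeartbeats 400000 in
include heA in
/-- **The witness in the cells**: a torus element `t ∈ T ∩ K_v` lies in `K0`, in `I`, and `w̃⁻¹ t w̃ ∈ I` (`w̃ = eA⁻¹ w`): its model matrix is `diag(tᵢᵢ(w))` with unit entries
(★ `v_torusEntry_eq_one_of_mem_cmLocalIntegralLevel`), and `w (eA t) w = diag` of the reversed entries (★ `coe_weylLongU_mul_mul_weylLongU_apply'`).
[cite: Tits1979, §3.5, §3.7] [cite: Rogawski1990, §1.10 p. 9; §4.5 p. 45] -/
theorem torus_mem_cells {ϖ : w.1.adicCompletion L}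
    (hd : HermitianLattice.UnramifiedLocalConjDatum (galAdicCompletionMap (L := L) (IsCMField.complexConj L) hw) ϖ)
    (g₁ : GL (Fin 3) (w.1.adicCompletion L)) (hg₁ : (g₁ : Matrix (Fin 3) (Fin 3) (w.1.adicCompletion L)) = Matrix.diagonal ![(1 : w.1.adicCompletion L), 1, ϖ])
    (K0 K1 I : Subgroup (Gqs L v))
    (hK0 : K0 = ((glInt 3 (w.1.adicCompletion L)).subgroupOf
      (unitaryGroupOfForm (galAdicCompletionMap (L := L) (IsCMField.complexConj L) hw) ((StdForm.antidiagonal 3).over (w.1.adicCompletion L)))).comap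
        eA.toMulEquiv.toMonoidHom)
    (hK1 : K1 = (((glInt 3 (w.1.adicCompletion L)).map (MulAut.conj g₁).toMonoidHom).subgroupOf
      (unitaryGroupOfForm (galAdicCompletionMap (L := L) (IsCMField.complexConj L) hw) ((StdForm.antidiagonal 3).over (w.1.adicCompletion L)))).comap
        eA.toMulEquiv.toMonoidHom)
    (hI : I = K0 ⊓ K1)
    (t : ↥(torusU (conjLocal L (IsCMField.complexConj L) v) (cmLocalForm L 3 v)))
    (ht : (t : ↥(unitaryGroupOfForm (conjLocal L (IsCMField.complexConj L) v) (cmLocalForm L 3 v))) ∈ cmLocalIntegralLevel L 3 (qsForm L) v) :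
    (t : ↥(unitaryGroupOfForm (conjLocal L (IsCMField.complexConj L) v) (cmLocalForm L 3 v))) ∈ K0 ∧
    (∀ i : Fin 2, (![(1 : ↥(unitaryGroupOfForm (conjLocal L (IsCMField.complexConj L) v) (cmLocalForm L 3 v))), eA.symm (weylLongU (galAdicCompletionMap (L := L) (IsCMField.complexConj L) hw) (rfl : (StdForm.antidiagonal 3).over (w.1.adicCompletion L) = _))] i)⁻¹ *
        (t : ↥(unitaryGroupOfForm (conjLocal L (IsCMField.complexConj L) v) (cmLocalForm L 3 v))) *
        (![(1 : ↥(unitaryGroupOfForm (conjLocal L (IsCMField.complexConj L) v) (cmLocalForm L 3 v))), eA.symm (weylLongU (galAdicCompletionMap (L := L) (IsCMField.complexConj L) hw) (rfl : (StdForm.antidiagonal 3).over (w.1.adicCompletion L) = _))] i) ∈ I) := by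
  have hK0mem : (t : ↥(unitaryGroupOfForm (conjLocal L (IsCMField.complexConj L) v) (cmLocalForm L 3 v))) ∈ K0 :=
    (mem_K0_iff_mem_integralLevel L v w hw eA heA K0 hK0 _).2 ht
  refine ⟨hK0mem, fun i => ?_⟩
  -- the model matrix of `eA t`: `diag(tᵢᵢ(w))`, unit entries
  obtain ⟨d, hdt⟩ := (mem_torusU_iff _).1 t.2
  have htmat : ((t : ↥(unitaryGroupOfForm (conjLocal L (IsCMField.complexConj L) v) (cmLocalForm L 3 v))).val.val : Matrix (Fin 3) (Fin 3) (LocalRing L v)) =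
      Matrix.diagonal fun k => ((d k : (LocalRing L v)ˣ) : LocalRing L v) := by
    have htval : (t : ↥(unitaryGroupOfForm (conjLocal L (IsCMField.complexConj L) v) (cmLocalForm L 3 v))).val = glDiagonal 3 (LocalRing L v) d := hdt.symm
    rw [htval, coe_glDiagonal]
  have hunit : ∀ k, Valued.v (((d k : (LocalRing L v)ˣ) : LocalRing L v) w) = 1 := fun k => by
    rw [← torusEntry_eq_of_glDiagonal_eq (conjLocal L (IsCMField.complexConj L) v) (cmLocalForm L 3 v) k t d hdt]
    exact v_torusEntry_eq_one_of_mem_cmLocalIntegralLevel L 3 v t ht k w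
  have hte : (((eA (t : ↥(unitaryGroupOfForm (conjLocal L (IsCMField.complexConj L) v) (cmLocalForm L 3 v))) : ↥(unitaryGroupOfForm (galAdicCompletionMap (L := L) (IsCMField.complexConj L) hw) ((StdForm.antidiagonal 3).over (w.1.adicCompletion L)))) : GL (Fin 3) (w.1.adicCompletion L)) : Matrix (Fin 3) (Fin 3) (w.1.adicCompletion L)) =
      Matrix.diagonal fun k => ((d k : (LocalRing L v)ˣ) : LocalRing L v) w := by
    refine Matrix.ext fun a b => ?_
    rw [coe_eA_apply L v w hw eA heA _ a b, htmat, Matrix.diagonal_apply, Matrix.diagonal_apply]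
    split_ifs with hab
    · rfl
    · rfl
  fin_cases i
  · -- cell `1`: `t ∈ I`
    have heq : (![(1 : ↥(unitaryGroupOfForm (conjLocal L (IsCMField.complexConj L) v) (cmLocalForm L 3 v))), eA.symm (weylLongU (galAdicCompletionMap (L := L) (IsCMField.complexConj L) hw) (rfl : (StdForm.antidiagonal 3).over (w.1.adicCompletion L) = _))] (0 : Fin 2))⁻¹ *
        (t : ↥(unitaryGroupOfForm (conjLocal L (IsCMField.complexConj L) v) (cmLocalForm L 3 v))) *
        (![(1 : ↥(unitaryGroupOfForm (conjLocal L (IsCMField.complexConj L) v) (cmLocalForm L 3 v))), eA.symm (weylLongU (galAdicCompletionMap (L := L) (IsCMField.complexConj L) hw) (rfl : (StdForm.antidiagonal 3).over (w.1.adicCompletion L) = _))] (0 : Fin 2)) = t := by simp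
    simp only [Fin.zero_eta]
    rw [heq]
    exact mem_I_of_model_diagonal L v w hw eA hd g₁ hg₁ K0 K1 I hK0 hK1 hI _ _ hunit hte
  · -- cell `w̃`: `w̃⁻¹ t w̃ ∈ I`, model matrix `w (eA t) w = diag` of the reversed entries
    let eU : ↥(unitaryGroupOfForm (conjLocal L (IsCMField.complexConj L) v) (cmLocalForm L 3 v)) ≃ₜ* ↥(unitaryGroupOfForm (galAdicCompletionMap (L := L) (IsCMField.complexConj L) hw) ((StdForm.antidiagonal 3).over (w.1.adicCompletion L))) := eA
    have hww : (weylLongU (galAdicCompletionMap (L := L) (IsCMField.complexConj L) hw) (rfl : (StdForm.antidiagonal 3).over (w.1.adicCompletion L) = _)) * (weylLongU (galAdicCompletionMap (L := L) (IsCMField.complexConj L) hw) (rfl : (StdForm.antidiagonal 3).over (w.1.adicCompletion L) = _)) = 1 := by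
      apply Subtype.ext; rw [Subgroup.coe_mul, coe_weylLongU, Subgroup.coe_one]; exact weylLong_mul_self 3 _
    have hwinv : (weylLongU (galAdicCompletionMap (L := L) (IsCMField.complexConj L) hw) (rfl : (StdForm.antidiagonal 3).over (w.1.adicCompletion L) = _))⁻¹ = (weylLongU (galAdicCompletionMap (L := L) (IsCMField.complexConj L) hw) (rfl : (StdForm.antidiagonal 3).over (w.1.adicCompletion L) = _)) := inv_eq_of_mul_eq_one_right hww
    have hmodel : eU ((![(1 : ↥(unitaryGroupOfForm (conjLocal L (IsCMField.complexConj L) v) (cmLocalForm L 3 v))), eA.symm (weylLongU (galAdicCompletionMap (L := L) (IsCMField.complexConj L) hw) (rfl : (StdForm.antidiagonal 3).over (w.1.adicCompletion L) = _))] (1 : Fin 2))⁻¹ * (t : ↥(unitaryGroupOfForm (conjLocal L (IsCMField.complexConj L) v) (cmLocalForm L 3 v))) * (![(1 : ↥(unitaryGroupOfForm (conjLocal L (IsCMField.complexConj L) v) (cmLocalForm L 3 v))), eA.symm (weylLongU (galAdicCompletionMap (L := L) (IsCMField.complexConj L) hw) (rfl : (StdForm.antidiagonal 3).over (w.1.adicCompletion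 L) = _))] (1 : Fin 2))) = (weylLongU (galAdicCompletionMap (L := L) (IsCMField.complexConj L) hw) (rfl : (StdForm.antidiagonal 3).over (w.1.adicCompletion L) = _)) * eU (t : ↥(unitaryGroupOfForm (conjLocal L (IsCMField.complexConj L) v) (cmLocalForm L 3 v))) * (weylLongU (galAdicCompletionMap (L := L) (IsCMField.complexConj L) hw) (rfl : (StdForm.antidiagonal 3).over (w.1.adicCompletion L) = _)) := by
      rw [map_mul, map_mul, map_inv, eA_vec L v w hw eA 1]
      simp only [Matrix.cons_val_one, Matrix.cons_val_fin_one]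
      rw [hwinv]
    refine mem_I_of_model_diagonal L v w hw eA hd g₁ hg₁ K0 K1 I hK0 hK1 hI _ (fun k => ((d (Fin.rev k) : (LocalRing L v)ˣ) : LocalRing L v) w)
      (fun k => hunit (Fin.rev k)) ?_
    change (((eU ((![(1 : ↥(unitaryGroupOfForm (conjLocal L (IsCMField.complexConj L) v) (cmLocalForm L 3 v))), eA.symm (weylLongU (galAdicCompletionMap (L := L) (IsCMField.complexConj L) hw) (rfl : (StdForm.antidiagonal 3).over (w.1.adicCompletion L) = _))] (1 : Fin 2))⁻¹ * (t : ↥(unitaryGroupOfForm (conjLocal L (IsCMField.complexConj L) v) (cmLocalForm L 3 v))) * (![(1 : ↥(unitaryGroupOfForm (conjLocal L (IsCMField.complexConj L) v) (cmLocalForm L 3 v))), eA.symm (weylLongU (galAdicCompletionMap (L := L) (IsCMField.complexConj L) hw) (rfl : (StdForm.antidiagonal 3).over (w.1.adicCompletion L) = _))] (1 : Fin 2))) : ↥(unitaryGroupOfForm (galAdicCompletionMap (L := L) (IsCMField.complexConj L) hw) ((StdForm.antidiagonal 3).over (w.1.adicCompletion L)))) : GL (Fin 3) (w.1.adicCompletion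 L)) : Matrix (Fin 3) (Fin 3) (w.1.adicCompletion L)) = _
    rw [hmodel]
    have hte' : (((eU (t : ↥(unitaryGroupOfForm (conjLocal L (IsCMField.complexConj L) v) (cmLocalForm L 3 v))) : ↥(unitaryGroupOfForm (galAdicCompletionMap (L := L) (IsCMField.complexConj L) hw) ((StdForm.antidiagonal 3).over (w.1.adicCompletion L)))) : GL (Fin 3) (w.1.adicCompletion L)) : Matrix (Fin 3) (Fin 3) (w.1.adicCompletion L)) =
        Matrix.diagonal fun k => ((d k : (LocalRing L v)ˣ) : LocalRing L v) w := hte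
    refine Matrix.ext fun a b => ?_
    rw [coe_weylLongU_mul_mul_weylLongU_apply', hte', Matrix.diagonal_apply, Matrix.diagonal_apply]
    by_cases hab : a = b
    · subst hab; simp
    · rw [if_neg (fun h => hab (Fin.rev_injective h)), if_neg hab]

set_option maxHeartbeats 1600000 in
-- instance-path unification between `Gqs L v` and the literal carrier of ★ `cmPrincipalSeries`
/-- **The witness acts on the inducing line by `χ t`**: for `t ∈ T ∩ K_v` (so `δ_B^{1∕2}(t) = 1`) the line of `χ∘proj ⊗ δ^{1∕2}` at `t` is the scalar `χ t`.
[cite: Rogawski1990, §12.1 p. 171] [cite: CartierCorvallis1979, §IV.1] -/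
theorem inducingLine_apply_torus (χ : ↥(torusU (conjLocal L (IsCMField.complexConj L) v) (cmLocalForm L 3 v)) →* ℂˣ)
    (t : ↥(torusU (conjLocal L (IsCMField.complexConj L) v) (cmLocalForm L 3 v)))
    (ht : (t : ↥(unitaryGroupOfForm (conjLocal L (IsCMField.complexConj L) v) (cmLocalForm L 3 v))) ∈ cmLocalIntegralLevel L 3 (qsForm L) v) :
    haveI := locallyCompactSpace_cmBorelU L 3 v
    (Representation.twist
      (((Representation.trivial ℂ ↥(torusU (conjLocal L (IsCMField.complexConj L) v) (cmLocalForm L 3 v)) ℂ).twist χ).comp (cmBorelTriple L 3 v).proj)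
      (rootDeltaChar (cmBorelTriple L 3 v).P))
        ⟨(t : ↥(unitaryGroupOfForm (conjLocal L (IsCMField.complexConj L) v) (cmLocalForm L 3 v))), torusU_le_borelU _ _ t.2⟩ = ((χ t : ℂˣ) : ℂ) • (1 : ℂ →ₗ[ℂ] ℂ) := by
  haveI := locallyCompactSpace_cmBorelU L 3 v
  have htB : ((t : ↥(unitaryGroupOfForm (conjLocal L (IsCMField.complexConj L) v) (cmLocalForm L 3 v))) ∈ (cmBorelTriple L 3 v).P) := torusU_le_borelU _ _ t.2
  have hproj : (cmBorelTriple L 3 v).proj ⟨_, htB⟩ = t := by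
    apply Subtype.ext
    exact (cmBorelTriple L 3 v).proj_apply_of_mem_M ⟨_, htB⟩ t.2
  have hδ : rootDeltaChar (cmBorelTriple L 3 v).P ⟨_, htB⟩ = 1 :=
    rootDeltaChar_borel_eq_one_of_mem_isCompact _ _ (cmLocalForm_eq_over L 3 v) (isCompact_isOpen_cmLocalIntegralLevel L 3 (qsForm L) v).1 ⟨_, htB⟩ ht
  apply LinearMap.ext
  intro z
  rw [Representation.twist_apply, hδ, Units.val_one, one_smul, MonoidHom.comp_apply, hproj, Representation.twist_apply, Representation.trivial_apply,
    LinearMap.smul_apply, Module.End.one_apply]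

end Summit.HodgeConjecture.HodgeConjecture.Cruxes.H413.F0P3cStCharTSPSLevelsCells

end
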